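import Summits.HubbardSuperconductivity.HubbardSuperconductivity.Theorems.AnisotropyChordTransferFibre3RowDPhase
import Summits.HubbardSuperconductivity.HubbardSuperconductivity.Theorems.AnisotropyChordTransferFibre3N1RowTrueVecMomenta
import Summits.HubbardSuperconductivity.HubbardSuperconductivity.Theorems.AnisotropyChordTransferFibre3KT2aRow

/-!
# Route `AnisotropyChord` / H0 rotor rung, row D (KT-2a) Stage-1 evaluator: the SLOT ATOMS `R_ψ(q)/V` at the true row-D vector

Layer B of the row-D program (p1 g29 memo ROWD-DESIGN-g29 §6; layer A = `…RowDPairs`, `…RowDPairsSmall`, `…RowDAtoms`, `…RowDPhase`).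
The closed `δ`-terms of g27's `closedPartU` (the `7 × 36` spec convolutions of `RhatCancelled`) are products of: slot `δ`-coefficients
`α_J = a`, `α_S = 1 − a + a/V` (p2's `vA`, `uu`), Kronecker deltas at integer points, and `V`-NORMALISED regular factors `R_ψ(q)/V`
(`closedPartU/V²` has no stray `V`: `ααα·d·d`, `αα·d·(R/V)`, `α·(R/V)(R/V)`).  This file evaluates the regular factors at torus images of
integer points through `RExpr` atoms of the row-D box:
* `rfacU_unweighted`, `rfacU_weighted` — `R_(e,1,0,α,β,γ)(q) = β + γ g(q)` (real), `R_(e,1,−1,α,β,γ)(q) = (1 − e^{−iq·e})(β + γ g(q))`;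
* ★ `eval_rJE`, ★ `eval_rSE` — `R_J/V = −a/V = rJE`, `R_S(q)/V = −c_s g(q)/V = rSE q` (`q` a grid point `|q|∞ ≤ 3` or `0`), via p2's dictionary
  transported to `xTrueD` (★ `dictD`: `eps ↦ 1/V`, `cs ↦ c_s`, `uu ↦ α_S`; `xTrueD_vG`);
* ★ `wD_eval`, ★ `sD_eval` — the weight atoms for a SIGNED multiplier `m`, `1 ≤ |m| ≤ 3`: `ŵ_{|m|} = (1 − cos mθ)/θ²`, `m·ŝ_{|m|} = sin(mθ)/θ`;
  hence ★ `seval_swt` — the small pair `swt m` denotes the gradient weight `1 − e^{−iθm}` (`|m| ≤ 3`, `swt 0 = 0`), and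
  ★ `rfacU_weighted_toTor` — `R_(ē,1,−1,α,β,γ)(q̄) = seval(swt (q·e)) · (β + γ g(q̄))` at integer points.
Prover seat `hubbard-h0-rotor-p1` g29 (route lead); helper for piece A = stmt-HubbardSuperconductivity-23918 of rung 19089
(`--supports`, helper class).  Nothing here proves superconductivity in the Hubbard model; lemmas for ONE row of ONE conditional reduction;
the rotor TARGET as originally worded stays FALSE (g15 verdict).  Tree imports only; no sorry.
-/

set_option linter.dupNamespace false
set_option autoImplicit false

open Literature.Analysis.ValidatedNumerics

namespace Summit.HubbardSuperconductivity.HubbardSuperconductivity.Theorems.AnisotropyChord.Transfer.Fibre3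

namespace RowD

open RowC L2.N1

variable (L : ℕ) [NeZero L]

/-! ## The regular factors of the uniform specs -/

omit [NeZero L] in
/-- unweighted slot: `R_(e,1,0,α,β,γ)(q) = β + γ g(q)` (real). -/
theorem rfacU_unweighted (lam2 α β γ : ℝ) (e q : Tor L) :
    RfacU L lam2 (e, 1, 0, α, β, γ) q = ((β + γ * gres L lam2 q : ℝ) : ℂ) := by
  unfold RfacU; push_cast; ring

omit [NeZero L] in
/-- `D_e`-weighted slot: `R_(e,1,−1,α,β,γ)(q) = (1 − e^{−iq·e})(β + γ g(q))`. -/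
theorem rfacU_weighted (lam2 α β γ : ℝ) (e q : Tor L) :
    RfacU L lam2 (e, 1, -1, α, β, γ) q = (1 - (starRingEnd ℂ) (phase L q e)) * ((β + γ * gres L lam2 q : ℝ) : ℂ) := by
  unfold RfacU; push_cast; ring

/-! ## More coordinates of the true row-D vector -/

section vals
variable (Δ lam2 : ℝ) (f : Tor L → ℝ)

/-- below `121` the row-D vector is p2's `xTrue`. -/
theorem xTrueD_lt {i : ℕ} (hi : i < 121) : xTrueD L Δ lam2 f i = xTrue L Δ lam2 f (Δ * f (K1 L)) i := by
  unfold xTrueD; rw [if_pos hi]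

/-- coordinate `2` is `ν = λ₂/t`. -/
theorem xTrueD_two : xTrueD L Δ lam2 f 2 = lam2 / (2 * Real.pi / L) ^ 2 := by
  rw [xTrueD_lt L Δ lam2 f (by norm_num), xTrue_lt16 L Δ lam2 f _ (by norm_num)]; rfl

/-- coordinate `3` is `a = Δ f(x̂)`. -/
theorem xTrueD_three : xTrueD L Δ lam2 f 3 = Δ * f (K1 L) := by
  rw [xTrueD_lt L Δ lam2 f (by norm_num), xTrue_lt16 L Δ lam2 f _ (by norm_num)]; rfl

/-- `vG 3 q ↦ t·g(q̄)` at a grid point `|q|∞ ≤ 3`, `q ≠ 0`. -/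
theorem xTrueD_vG {q : ℤ × ℤ} (hq : q ∈ gridPts 3) :
    (vG 3 q).eval (xTrueD L Δ lam2 f) = (2 * Real.pi / L) ^ 2 * gres L lam2 (B1.toTor L q) := by
  rw [← eval_vG L Δ lam2 f hq (Δ * f (K1 L))]
  have hi : gridIdx 3 q < (gridPts 3).length :=
    List.findIdx_lt_length_of_exists ⟨q, hq, beq_self_eq_true q⟩
  rw [length_gridPts_three] at hi
  simp only [vG, RExpr.eval]
  exact xTrueD_lt L Δ lam2 f (by omega)

/-- `t/(4π²) = 1/V`. -/
theorem t_div_four_pi_sq : (2 * Real.pi / L) ^ 2 * (4 * Real.pi ^ 2)⁻¹ = 1 / (L : ℝ) ^ 2 := by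
  have hπ : Real.pi ≠ 0 := Real.pi_ne_zero
  have hL : (L : ℝ) ≠ 0 := by exact_mod_cast NeZero.ne L
  field_simp
  norm_num

/-- ★ p2's scalar dictionary at the row-D vector: `eps ↦ 1/V`, `cs ↦ c_s`, `uu ↦ α_S = 1 − a + a/V` (ground profile, `L ≥ 5`, `0 ≤ Δ < 1`, `0 < λ₂`). -/
theorem dictD (hL : 5 ≤ L) (hΔ0 : 0 ≤ Δ) (hΔ1 : Δ < 1) (hf : IsGroundTwoMagnon L Δ lam2 f) (hlam : 0 < lam2) :
    eps.eval (xTrueD L Δ lam2 f) = 1 / (L : ℝ) ^ 2 ∧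
    cs.eval (xTrueD L Δ lam2 f) = cS L Δ lam2 f ∧
    uu.eval (xTrueD L Δ lam2 f) = 1 - Δ * f (K1 L) + Δ * f (K1 L) / (L : ℝ) ^ 2 := by
  obtain ⟨_, dcs, _, _, _⟩ := dict_at_xTrue L Δ lam2 f hL hΔ0 hΔ1 hf hlam
  obtain ⟨eeps, euu⟩ := eval_eps_uu (xTrueD L Δ lam2 f)
  have h0 := xTrueD_zero L Δ lam2 f
  have h1 := xTrueD_one L Δ lam2 f
  have h3 := xTrueD_three L Δ lam2 f
  have hEps : xTrueD L Δ lam2 f 0 * (4 * xTrueD L Δ lam2 f 1)⁻¹ = 1 / (L : ℝ) ^ 2 := by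
    rw [h0, h1]; exact t_div_four_pi_sq L
  refine ⟨by rw [eeps, hEps], ?_, by rw [euu, hEps, h3]; ring⟩
  -- `cs` mentions only coordinates `0,1,2,3`, where `xTrueD = xTrue`
  rw [← dcs, eval_cs, eval_cs, xTrueD_lt L Δ lam2 f (by norm_num), xTrueD_lt L Δ lam2 f (by norm_num),
    xTrueD_lt L Δ lam2 f (by norm_num), xTrueD_lt L Δ lam2 f (by norm_num)]

end vals

/-! ## The `V`-normalised regular factors as `RExpr` atoms -/

/-- `ĝ(q)/(4π²)` (`= g(q̄)/V` at the true vector); `0` for `q = 0`. -/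
def gOvE (q : ℤ × ℤ) : RExpr := if q = (0, 0) then cst 0 else .mul (vG 3 q) (.inv (.mul (cst 4) vPi2))

/-- `R_J/V = −a/V` (the `JU` slot's regular factor is the constant `−a`). -/
def rJE : RExpr := .neg (.mul vA eps)

/-- `R_S(q)/V = −c_s g(q̄)/V`. -/
def rSE (q : ℤ × ℤ) : RExpr := .neg (.mul cs (gOvE q))

section atoms
variable (Δ lam2 : ℝ) (f : Tor L → ℝ)

/-- ★ `gOvE q ↦ g(q̄)/V` for `q = 0` or a grid point. -/
theorem eval_gOvE {q : ℤ × ℤ} (hq : q = (0, 0) ∨ q ∈ gridPts 3) :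
    (gOvE q).eval (xTrueD L Δ lam2 f) = gres L lam2 (B1.toTor L q) / (L : ℝ) ^ 2 := by
  unfold gOvE
  rcases hq with h | h
  · rw [if_pos h, h]
    have : B1.toTor L ((0 : ℤ), (0 : ℤ)) = 0 := B1.toTor_zero L
    rw [this]; unfold gres; simp [cst, RExpr.eval]
  · rw [if_neg (ne_zero_of_grid q h)]
    have hG := xTrueD_vG L Δ lam2 f h
    simp only [RExpr.eval, cst, vPi2] at hG ⊢
    rw [hG, xTrueD_one, div_eq_mul_one_div (gres L lam2 _) ((L : ℝ) ^ 2), ← t_div_four_pi_sq L]; push_cast; ring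

/-- ★ `rJE ↦ R_J(q)/V` (any `q`, any weight vector `e`; ground profile). -/
theorem eval_rJE (hL : 5 ≤ L) (hΔ0 : 0 ≤ Δ) (hΔ1 : Δ < 1) (hf : IsGroundTwoMagnon L Δ lam2 f) (hlam : 0 < lam2)
    (α : ℝ) (e q : Tor L) :
    ((rJE.eval (xTrueD L Δ lam2 f) : ℝ) : ℂ) = RfacU L lam2 (e, 1, 0, α, -(Δ * f (K1 L)), 0) q / (L : ℂ) ^ 2 := by
  obtain ⟨deps, -, -⟩ := dictD L Δ lam2 f hL hΔ0 hΔ1 hf hlam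
  rw [rfacU_unweighted]
  simp only [rJE, RExpr.eval, vA]
  rw [deps, xTrueD_three]
  have hL0 : (L : ℂ) ≠ 0 := by exact_mod_cast NeZero.ne L
  push_cast
  field_simp
  ring

/-- ★ `rSE q ↦ R_S(q̄)/V` (`q = 0` or a grid point; ground profile). -/
theorem eval_rSE (hL : 5 ≤ L) (hΔ0 : 0 ≤ Δ) (hΔ1 : Δ < 1) (hf : IsGroundTwoMagnon L Δ lam2 f) (hlam : 0 < lam2)
    (α : ℝ) (e : Tor L) {q : ℤ × ℤ} (hq : q = (0, 0) ∨ q ∈ gridPts 3) :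
    (((rSE q).eval (xTrueD L Δ lam2 f) : ℝ) : ℂ) = RfacU L lam2 (e, 1, 0, α, 0, -cS L Δ lam2 f) (B1.toTor L q) / (L : ℂ) ^ 2 := by
  obtain ⟨-, dcs, -⟩ := dictD L Δ lam2 f hL hΔ0 hΔ1 hf hlam
  rw [rfacU_unweighted]
  simp only [rSE, RExpr.eval]
  rw [dcs, eval_gOvE L Δ lam2 f hq]
  have hL0 : (L : ℂ) ≠ 0 := by exact_mod_cast NeZero.ne L
  push_cast
  field_simp
  ring

/-! ## The gradient weight for a signed multiplier -/

/-- ★ `ŵ_{|m|} ↦ (1 − cos(mθ))/θ²` for `1 ≤ |m| ≤ 3` (cos is even). -/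
theorem wD_eval {m : ℤ} (hm1 : 1 ≤ m.natAbs) (hm3 : m.natAbs ≤ 3) :
    (wE m.natAbs).eval (xTrueD L Δ lam2 f) = (1 - Real.cos ((m : ℝ) * (2 * Real.pi / L))) / (2 * Real.pi / L) ^ 2 := by
  simp only [wE, RExpr.eval]
  rw [xTrueD_w L Δ lam2 f hm1 hm3]
  set n := m.natAbs with hn
  rcases Int.natAbs_eq m with h | h
  · rw [h, ← hn]; push_cast; ring_nf
  · rw [h, ← hn]; push_cast
    rw [show -((n : ℝ)) * (2 * Real.pi / L) = -((n : ℝ) * (2 * Real.pi / L)) by ring, Real.cos_neg]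

/-- ★ `m·ŝ_{|m|} ↦ sin(mθ)/θ` for `1 ≤ |m| ≤ 3` (sin is odd). -/
theorem sD_eval (hL : 3 ≤ L) {m : ℤ} (hm1 : 1 ≤ m.natAbs) (hm3 : m.natAbs ≤ 3) :
    (m : ℝ) * (sE m.natAbs).eval (xTrueD L Δ lam2 f) = Real.sin ((m : ℝ) * (2 * Real.pi / L)) / (2 * Real.pi / L) := by
  have hLpos : (0 : ℝ) < L := by exact_mod_cast (show 0 < L by omega)
  have hθ : (2 * Real.pi / L : ℝ) ≠ 0 := by positivity
  simp only [sE, RExpr.eval]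
  rw [xTrueD_s L Δ lam2 f hm1 (by omega)]
  set n := m.natAbs with hn
  have hnR : (n : ℝ) ≠ 0 := by exact_mod_cast (show n ≠ 0 by omega)
  rcases Int.natAbs_eq m with h | h
  · rw [h, ← hn]; push_cast; field_simp
  · rw [h, ← hn]; push_cast
    rw [show -((n : ℝ)) * (2 * Real.pi / L) = -((n : ℝ) * (2 * Real.pi / L)) by ring, Real.sin_neg]
    field_simp

/-- the gradient weight `1 − e^{−iθm}` as a SMALL pair for a signed multiplier `|m| ≤ 3` (`0` for `m = 0`). -/
def swt (m : ℤ) : RExpr × RExpr := if m = 0 then (cst 0, cst 0) else sweight (wE m.natAbs) (sE m.natAbs) m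

/-- ★ `swt m ↦ 1 − e^{−iθm}` at the true row-D vector (`|m| ≤ 3`, `L ≥ 3`). -/
theorem seval_swt (hL : 3 ≤ L) {m : ℤ} (hm3 : m.natAbs ≤ 3) :
    seval (2 * Real.pi / L) (xTrueD L Δ lam2 f) (swt m)
      = 1 - Complex.exp (-(Complex.I * ((2 * Real.pi / L : ℝ) : ℂ) * (m : ℂ))) := by
  unfold swt
  by_cases hm : m = 0
  · rw [if_pos hm, hm]; simp [seval, cst, RExpr.eval]
  · rw [if_neg hm]
    have hLpos : (0 : ℝ) < L := by exact_mod_cast (show 0 < L by omega)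
    have hθ : (2 * Real.pi / L : ℝ) ≠ 0 := by positivity
    have hm1 : 1 ≤ m.natAbs := Int.natAbs_pos.mpr hm
    exact seval_sweight (2 * Real.pi / L) (xTrueD L Δ lam2 f) (xTrueD_zero L Δ lam2 f) hθ _ _ m
      (wD_eval L Δ lam2 f hm1 hm3) (sD_eval L Δ lam2 f hL hm1 hm3)

/-- ★ the weighted regular factor at integer points: `R_(ē,1,−1,α,β,γ)(q̄) = (1 − e^{−iθ(q·e)})·(β + γ g(q̄)) = seval(swt (q·e))·(β + γ g(q̄))`
(`|q·e| ≤ 3`, `L ≥ 3`). -/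
theorem rfacU_weighted_toTor (hL : 3 ≤ L) (α β γ : ℝ) (q e : ℤ × ℤ) (hm : (qdot q e).natAbs ≤ 3) :
    RfacU L lam2 (B1.toTor L e, 1, -1, α, β, γ) (B1.toTor L q)
      = seval (2 * Real.pi / L) (xTrueD L Δ lam2 f) (swt (qdot q e)) * ((β + γ * gres L lam2 (B1.toTor L q) : ℝ) : ℂ) := by
  rw [rfacU_weighted, conj_phase_toTor_E4 L q e, seval_swt L Δ lam2 f hL hm]

end atoms

end RowD

end Summit.HubbardSuperconductivity.HubbardSuperconductivity.Theorems.AnisotropyChord.Transfer.Fibre3
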